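import Literature.Topology.FourManifolds.SmaleHomologySpheresPropA
import Literature.Topology.FourManifolds.CellularSets
import Literature.Topology.FourManifolds.DiscFilling
import Literature.Topology.FourManifolds.BoundarySignature
import Literature.AlgebraicTopology.Homotopy.BallComplementRetract
import Literature.AlgebraicTopology.Homotopy.HomotopyGroupsGeneralPosition
import HarnessLib

/-!
# Removing a disc from a closed manifold: `M₀ = M ∖ D̊` bounds the ordinary sphere, and `M₀ ∪ cone(bM₀) = M`

Topic `Literature/Topology/FourManifolds`. Infrastructure for the printed proof of Kervaire–Milnor's
**Lemma 7.4** (*Groups of homotopy spheres: I*, Ann. of Math. (2) 77 (1963), p. 529): "there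
exists a closed … `4m`-manifold whose signature is non-zero. Removing the interior of an imbedded
`4m`-disk from this manifold, we obtain the required … manifold `M₀`" — whose boundary is "the
ordinary `(4m-1)`-sphere" and whose signature `σ(M₀)` is, by the footnote pp. 528–529 ("we can
adjoin a cone over the boundary, thus obtaining a closed homology manifold with the same
signature"), that of `M₀ ∪ cone(bM₀)`, i.e. of `M` again. For the tree's objects
(`Literature.Topology.FourManifolds.NullCobordism`, the closed model
`Literature.Topology.FourManifolds.ClosedModel n W = OnePoint (W ∖ ∂W)` of `BoundarySignature.lean`
on which `σ` is computed, and the ball removal `BallRemovalData.K ≅ W ∖ i(B)` of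
`BallRemovalCobordism.lean`, applied to a closed manifold through
`SmaleHomologySpheres.nullCobordismOfClosed`), everything below is PROVED; no named facts:

* `ballCollapse`, `ballExpand` — the radial collapse `v ↦ c(‖v‖) v` of a real normed space
  crushing the closed unit ball to `0`, the identity outside the ball of radius `2`, a bijection
  `{1 < ‖v‖} → {v ≠ 0}` (explicit inverse `ballExpand`), continuous;
* `discCollapse e` — its transport along an open embedding `e : ℝⁿ⁺¹ → X` of a Hausdorff space,
  extended by the identity (`extendAlong`, `CellularSets.lean`): continuous, fibre over `e 0`
  exactly the closed disc `e(𝔻)`, a bijection `X ∖ e(𝔻) → X ∖ {e 0}`;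
* `ClosedMinusBall.nullCobordism D : NullCobordism n 𝕊ⁿ` — for a closed smooth
  `(n+1)`-manifold `X` and ball-removal data `D` (a smooth disc `i`), **`K ≅ X ∖ i(B)` is a
  null-cobordism of the standard sphere**, the boundary inclusion being `i|_{Sⁿ}`
  (`BallRemovalData.cobordism` of `(X; ∅)` reversed, `NullCobordism.ofCobordism`);
* `ClosedMinusBall.toClosed D : D.K → X` (the identification `K ≅ X ∖ i(B) ⊆ X`, a topological
  embedding with range `X ∖ i(B)` carrying exactly `∂K` onto `i(Sⁿ)`), `ClosedMinusBall.collapse`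
  (followed by the disc collapse: `∂K ↦ i 0`, injective on the interior, onto `X ∖ {i 0}`);
* `ClosedMinusBall.closedModelHomeomorph D : ClosedModel n D.K ≃ₜ X` — **the closed model
  `K ∪ cone(∂K)` of `X ∖ i(B)` is homeomorphic to `X`** (`∞ ↦ i 0`): the collapse descends through
  the quotient map `K → K ∪ cone(∂K)` to a continuous bijection of a compact space onto a
  Hausdorff space;
* `ClosedMinusBall.pathConnectedSpace_K`, `connectedSpace_K` — `X ∖ i(B)` is (path) connected
  for `X` connected of dimension `≥ 2` (a retract of the punctured manifold,
  `BallComplement.retr`, `isPathConnected_compl_singleton_of_chartedSpace`).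

Consumers: the reduction of Lemma 7.4 to Milnor–Kervaire [18] (`HomotopySpheresSignatureLemma74*.lean`):
with `signature_intersectionForm_comap_holds` the homeomorphism gives `σ(M₀) = σ(M)`.

## References

* M. A. Kervaire, J. W. Milnor, *Groups of homotopy spheres: I*, Ann. of Math. (2) 77 (1963),
  504–537: proof of Lemma 7.4 (p. 529), footnote pp. 528–529, proof of Lemma 2.3 (p. 506).
  [KervaireMilnorAnnals1963]
* A. Hatcher, *Algebraic Topology*, CUP 2002, Ch. 0 (quotients `X/A`, collapsing a disc),
  Prop. 2.22. [Hatcher2002]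
* J. Milnor, *Lectures on the h-cobordism theorem*, Princeton 1965, §1 (closed manifolds as
  triads `(W; ∅, ∅)`). [MilnorHCobordism1965]
-/

open scoped Manifold ContDiff Topology
open Set Function Metric Filter Topology

noncomputable section

namespace Literature.Topology.FourManifolds

/-! ### The radial collapse of the closed unit ball -/

section BallCollapse

variable {F : Type*} [NormedAddCommGroup F] [NormedSpace ℝ F]

/-- The radial profile of the collapse: `0` on `[0, 1]`, `2 - 2/r` on `[1, 2]`, `1` on `[2, ∞)`.
[folklore] -/
def ballCollapseCoeff (r : ℝ) : ℝ := max 0 (min (2 - 2 / r) 1)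

/-- `0 ≤ ballCollapseCoeff r`. [folklore] -/
theorem ballCollapseCoeff_nonneg (r : ℝ) : 0 ≤ ballCollapseCoeff r := le_max_left _ _

/-- `ballCollapseCoeff r ≤ 1`. [folklore] -/
theorem ballCollapseCoeff_le_one (r : ℝ) : ballCollapseCoeff r ≤ 1 :=
  max_le zero_le_one (min_le_right _ _)

/-- On `(0, 1]` the profile vanishes. [folklore] -/
theorem ballCollapseCoeff_of_le_one {r : ℝ} (hr0 : 0 < r) (hr : r ≤ 1) : ballCollapseCoeff r = 0 := by
  have h : 2 ≤ 2 / r := by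
    rw [le_div_iff₀ hr0]; nlinarith
  unfold ballCollapseCoeff
  exact max_eq_left ((min_le_left _ _).trans (by linarith))

/-- On `[2, ∞)` the profile is `1`. [folklore] -/
theorem ballCollapseCoeff_of_two_le {r : ℝ} (hr : 2 ≤ r) : ballCollapseCoeff r = 1 := by
  have hr0 : 0 < r := by linarith
  have h : 2 / r ≤ 1 := by
    rw [div_le_iff₀ hr0]; linarith
  unfold ballCollapseCoeff
  rw [min_eq_right (by linarith), max_eq_right zero_le_one]

/-- On `(1, 2]` the profile is `2 - 2/r`. [folklore] -/
theorem ballCollapseCoeff_of_mem {r : ℝ} (hr1 : 1 < r) (hr2 : r ≤ 2) :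
    ballCollapseCoeff r = 2 - 2 / r := by
  have hr0 : 0 < r := by linarith
  have h1 : 1 ≤ 2 / r := by
    rw [le_div_iff₀ hr0]; linarith
  have h2 : 2 / r < 2 := by
    rw [div_lt_iff₀ hr0]; linarith
  unfold ballCollapseCoeff
  rw [min_eq_left (by linarith), max_eq_right (by linarith)]

/-- On `(1, ∞)` the profile is positive. [folklore] -/
theorem ballCollapseCoeff_pos {r : ℝ} (hr1 : 1 < r) : 0 < ballCollapseCoeff r := by
  rcases le_or_gt r 2 with h | h
  · rw [ballCollapseCoeff_of_mem hr1 h]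
    have hr0 : 0 < r := by linarith
    have h2 : 2 / r < 2 := by
      rw [div_lt_iff₀ hr0]; linarith
    linarith
  · rw [ballCollapseCoeff_of_two_le h.le]; exact one_pos

/-- The profile is continuous at every `r ≠ 0`. [folklore] -/
theorem continuousAt_ballCollapseCoeff {r : ℝ} (hr : r ≠ 0) : ContinuousAt ballCollapseCoeff r := by
  unfold ballCollapseCoeff
  exact continuousAt_const.max
    ((continuousAt_const.sub (continuousAt_const.div continuousAt_id hr)).min continuousAt_const)

/-- **The radial collapse of the closed unit ball** of a real normed space: `v ↦ c(‖v‖) v` with the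
profile `c = ballCollapseCoeff`; it crushes the closed unit ball to `0`, is the identity outside the
ball of radius `2`, and maps the exterior `{1 < ‖v‖}` of the closed unit ball bijectively onto
`{v ≠ 0}` (Hatcher, *Algebraic Topology* (2002), Ch. 0, p. 11 ff.: collapsing a contractible
subcomplex / a disc). [folklore] -/
def ballCollapse (v : F) : F := ballCollapseCoeff ‖v‖ • v

/-- The collapse crushes the closed unit ball to `0`. [folklore] -/
theorem ballCollapse_of_norm_le_one {v : F} (hv : ‖v‖ ≤ 1) : ballCollapse v = 0 := by
  by_cases h0 : v = 0
  · rw [h0, ballCollapse, smul_zero]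
  · rw [ballCollapse, ballCollapseCoeff_of_le_one (norm_pos_iff.2 h0) hv, zero_smul]

/-- The collapse is the identity outside the ball of radius `2`. [folklore] -/
theorem ballCollapse_of_two_le_norm {v : F} (hv : 2 ≤ ‖v‖) : ballCollapse v = v := by
  rw [ballCollapse, ballCollapseCoeff_of_two_le hv, one_smul]

/-- `‖ballCollapse v‖ = c(‖v‖) ‖v‖`. [folklore] -/
theorem norm_ballCollapse (v : F) : ‖ballCollapse v‖ = ballCollapseCoeff ‖v‖ * ‖v‖ := by
  rw [ballCollapse, norm_smul, Real.norm_of_nonneg (ballCollapseCoeff_nonneg _)]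

/-- `‖ballCollapse v‖ ≤ ‖v‖`. [folklore] -/
theorem norm_ballCollapse_le (v : F) : ‖ballCollapse v‖ ≤ ‖v‖ := by
  rw [norm_ballCollapse]
  exact (mul_le_of_le_one_left (norm_nonneg _) (ballCollapseCoeff_le_one _))

/-- Outside the closed unit ball the collapse does not vanish. [folklore] -/
theorem ballCollapse_ne_zero {v : F} (hv : 1 < ‖v‖) : ballCollapse v ≠ 0 := by
  have h0 : v ≠ 0 := by
    rintro rfl; rw [norm_zero] at hv; linarith
  exact smul_ne_zero (ballCollapseCoeff_pos hv).ne' h0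

/-- The collapse vanishes exactly on the closed unit ball. [folklore] -/
theorem ballCollapse_eq_zero_iff {v : F} : ballCollapse v = 0 ↔ ‖v‖ ≤ 1 :=
  ⟨fun h => not_lt.1 fun h' => ballCollapse_ne_zero h' h, ballCollapse_of_norm_le_one⟩

/-- The collapse is continuous. [folklore] -/
theorem continuous_ballCollapse : Continuous (ballCollapse : F → F) := by
  rw [continuous_iff_continuousAt]
  intro v
  by_cases h0 : v = 0
  · subst h0
    rw [ContinuousAt, ballCollapse, smul_zero]
    refine tendsto_zero_iff_norm_tendsto_zero.2 ?_
    refine squeeze_zero (fun w => norm_nonneg _) (fun w => norm_ballCollapse_le w) ?_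
    simpa using (continuous_norm (E := F)).tendsto (0 : F)
  · exact ((continuousAt_ballCollapseCoeff (norm_ne_zero_iff.2 h0)).comp
      continuous_norm.continuousAt).smul continuousAt_id

/-- The radial profile of the inverse of the collapse on `{v ≠ 0}`: `1/2 + 1/s` on `(0, 2]`, `1` on
`[2, ∞)`. [folklore] -/
def ballExpandCoeff (s : ℝ) : ℝ := max (2⁻¹ + 1 / s) 1

/-- `1 ≤ ballExpandCoeff s`. [folklore] -/
theorem one_le_ballExpandCoeff (s : ℝ) : 1 ≤ ballExpandCoeff s := le_max_right _ _

/-- On `(0, 2]` the inverse profile is `1/2 + 1/s`. [folklore] -/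
theorem ballExpandCoeff_of_le_two {s : ℝ} (hs0 : 0 < s) (hs : s ≤ 2) :
    ballExpandCoeff s = 2⁻¹ + 1 / s := by
  have h : 2⁻¹ ≤ 1 / s := by
    rw [le_div_iff₀ hs0]; linarith
  unfold ballExpandCoeff
  exact max_eq_left (by linarith)

/-- On `[2, ∞)` the inverse profile is `1`. [folklore] -/
theorem ballExpandCoeff_of_two_le {s : ℝ} (hs : 2 ≤ s) : ballExpandCoeff s = 1 := by
  have hs0 : 0 < s := by linarith
  have h : 1 / s ≤ 2⁻¹ := by
    rw [div_le_iff₀ hs0]; linarith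
  unfold ballExpandCoeff
  exact max_eq_right (by linarith)

/-- **The inverse of the collapse on `{v ≠ 0}`**: `w ↦ c'(‖w‖) w`. [folklore] -/
def ballExpand (w : F) : F := ballExpandCoeff ‖w‖ • w

/-- `‖ballExpand w‖ = c'(‖w‖) ‖w‖`. [folklore] -/
theorem norm_ballExpand (w : F) : ‖ballExpand w‖ = ballExpandCoeff ‖w‖ * ‖w‖ := by
  rw [ballExpand, norm_smul,
    Real.norm_of_nonneg (zero_le_one.trans (one_le_ballExpandCoeff _))]

/-- The expansion of a non-zero vector lies outside the closed unit ball. [folklore] -/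
theorem one_lt_norm_ballExpand {w : F} (hw : w ≠ 0) : 1 < ‖ballExpand w‖ := by
  have hs0 : 0 < ‖w‖ := norm_pos_iff.2 hw
  rw [norm_ballExpand]
  rcases le_or_gt ‖w‖ 2 with h | h
  · rw [ballExpandCoeff_of_le_two hs0 h, add_mul, one_div, inv_mul_cancel₀ hs0.ne']
    linarith [mul_pos (by norm_num : (0 : ℝ) < 2⁻¹) hs0]
  · rw [ballExpandCoeff_of_two_le h.le, one_mul]
    linarith

/-- `ballCollapse ∘ ballExpand = id` on `{w ≠ 0}`. [folklore] -/
theorem ballCollapse_ballExpand {w : F} (hw : w ≠ 0) : ballCollapse (ballExpand w) = w := by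
  have hs0 : 0 < ‖w‖ := norm_pos_iff.2 hw
  rw [ballCollapse, norm_ballExpand, ballExpand, smul_smul]
  rcases le_or_gt ‖w‖ 2 with h | h
  · -- `‖w‖ ≤ 2`: the expanded norm is `r = ‖w‖/2 + 1 ∈ (1, 2]`
    have hc : ballExpandCoeff ‖w‖ = 2⁻¹ + 1 / ‖w‖ := ballExpandCoeff_of_le_two hs0 h
    have hr : (2⁻¹ + 1 / ‖w‖) * ‖w‖ = ‖w‖ / 2 + 1 := by
      field_simp
    rw [hc, hr, ballCollapseCoeff_of_mem (by linarith) (by linarith)]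
    have : (2 - 2 / (‖w‖ / 2 + 1)) * (2⁻¹ + 1 / ‖w‖) = 1 := by
      field_simp
      ring
    rw [this, one_smul]
  · rw [ballExpandCoeff_of_two_le h.le, one_mul, ballCollapseCoeff_of_two_le h.le, one_mul,
      one_smul]

/-- `ballExpand ∘ ballCollapse = id` on `{1 < ‖v‖}`. [folklore] -/
theorem ballExpand_ballCollapse {v : F} (hv : 1 < ‖v‖) : ballExpand (ballCollapse v) = v := by
  have hv0 : 0 < ‖v‖ := by linarith
  rw [ballExpand, norm_ballCollapse, ballCollapse, smul_smul]
  rcases le_or_gt ‖v‖ 2 with h | h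
  · -- `1 < ‖v‖ ≤ 2`: the collapsed norm is `s = 2‖v‖ - 2 ∈ (0, 2]`
    have hc : ballCollapseCoeff ‖v‖ = 2 - 2 / ‖v‖ := ballCollapseCoeff_of_mem hv h
    have hs : (2 - 2 / ‖v‖) * ‖v‖ = 2 * ‖v‖ - 2 := by
      field_simp
    rw [hc, hs, ballExpandCoeff_of_le_two (by linarith) (by linarith)]
    have : (2⁻¹ + 1 / (2 * ‖v‖ - 2)) * (2 - 2 / ‖v‖) = 1 := by
      have h1 : (2 * ‖v‖ - 2) ≠ 0 := by linarith
      have h2 : (‖v‖ - 1) ≠ 0 := by linarith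
      have h3 : (-1 + ‖v‖) ≠ 0 := by linarith
      rw [show (2 * ‖v‖ - 2) = 2 * (‖v‖ - 1) by ring]
      field_simp
      ring
    rw [this, one_smul]
  · rw [ballCollapseCoeff_of_two_le h.le, one_mul, ballExpandCoeff_of_two_le h.le, one_mul,
      one_smul]

/-- The collapse is injective outside the closed unit ball. [folklore] -/
theorem ballCollapse_injOn : InjOn (ballCollapse : F → F) {v | 1 < ‖v‖} := fun v hv v' hv' h => by
  rw [← ballExpand_ballCollapse (show 1 < ‖v‖ from hv), h,
    ballExpand_ballCollapse (show 1 < ‖v'‖ from hv')]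

end BallCollapse

/-! ### Collapsing an embedded closed disc in a Hausdorff space -/

section DiscCollapse

variable {n : ℕ} {X : Type*} [TopologicalSpace X] {e : EuclideanSpace ℝ (Fin (n + 1)) → X}

/-- **Collapsing the closed disc `e(𝔻)` of a Hausdorff space**: the radial collapse transported
along the open embedding `e : ℝⁿ⁺¹ → X` and extended by the identity (`extendAlong`,
`CellularSets.lean`). [folklore] -/
def discCollapse (e : EuclideanSpace ℝ (Fin (n + 1)) → X) : X → X := extendAlong e ballCollapse

/-- The disc collapse is continuous (the radial collapse is the identity off the compact ball of
radius `2`; `continuous_extendAlong`). [folklore] -/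
theorem continuous_discCollapse [T2Space X] (he : IsOpenEmbedding e) :
    Continuous (discCollapse e) :=
  continuous_extendAlong he continuous_ballCollapse (isCompact_closedBall (0 : EuclideanSpace ℝ
    (Fin (n + 1))) 2) fun v hv => ballCollapse_of_two_le_norm (by
      rw [mem_closedBall_zero_iff, not_le] at hv; exact hv.le)

/-- On the disc, the collapse is the transported radial collapse. [folklore] -/
theorem discCollapse_apply_image (he : IsOpenEmbedding e) (v : EuclideanSpace ℝ (Fin (n + 1))) :
    discCollapse e (e v) = e (ballCollapse v) :=
  extendAlong_apply_image he.injective _ v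

omit [TopologicalSpace X] in
/-- Off the disc, the collapse is the identity. [folklore] -/
theorem discCollapse_apply_of_not_mem {y : X} (hy : y ∉ range e) : discCollapse e y = y :=
  extendAlong_apply_of_not_mem _ hy

/-- The fibre of the collapse over the centre `e 0` is exactly the closed disc `e(𝔻)`. [folklore] -/
theorem discCollapse_eq_center_iff (he : IsOpenEmbedding e) {y : X} :
    discCollapse e y = e 0 ↔ y ∈ e '' closedBall (0 : EuclideanSpace ℝ (Fin (n + 1))) 1 := by
  constructor
  · intro h
    by_cases hy : y ∈ range e
    · obtain ⟨v, rfl⟩ := hy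
      rw [discCollapse_apply_image he, he.injective.eq_iff, ballCollapse_eq_zero_iff] at h
      exact mem_image_of_mem e (mem_closedBall_zero_iff.2 h)
    · rw [discCollapse_apply_of_not_mem hy] at h
      exact absurd ⟨0, h.symm⟩ hy
  · rintro ⟨v, hv, rfl⟩
    rw [discCollapse_apply_image he, ballCollapse_of_norm_le_one (mem_closedBall_zero_iff.1 hv)]

/-- The collapse is injective off the closed disc. [folklore] -/
theorem discCollapse_injOn (he : IsOpenEmbedding e) :
    InjOn (discCollapse e) (e '' closedBall (0 : EuclideanSpace ℝ (Fin (n + 1))) 1)ᶜ := by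
  have key : ∀ v : EuclideanSpace ℝ (Fin (n + 1)), e v ∉ e '' closedBall 0 1 → 1 < ‖v‖ := by
    intro v hv
    by_contra h
    exact hv (mem_image_of_mem e (mem_closedBall_zero_iff.2 (not_lt.1 h)))
  intro y hy y' hy' h
  by_cases hyr : y ∈ range e
  · obtain ⟨v, rfl⟩ := hyr
    by_cases hyr' : y' ∈ range e
    · obtain ⟨v', rfl⟩ := hyr'
      rw [discCollapse_apply_image he, discCollapse_apply_image he, he.injective.eq_iff] at h
      rw [ballCollapse_injOn (key v hy) (key v' hy') h]
    · rw [discCollapse_apply_image he, discCollapse_apply_of_not_mem hyr'] at h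
      exact absurd ⟨_, h⟩ hyr'
  · by_cases hyr' : y' ∈ range e
    · obtain ⟨v', rfl⟩ := hyr'
      rw [discCollapse_apply_of_not_mem hyr, discCollapse_apply_image he] at h
      exact absurd ⟨_, h.symm⟩ hyr
    · rwa [discCollapse_apply_of_not_mem hyr, discCollapse_apply_of_not_mem hyr'] at h

/-- The collapse maps the complement of the closed disc onto the complement of the centre.
[folklore] -/
theorem discCollapse_surjOn (he : IsOpenEmbedding e) :
    SurjOn (discCollapse e) (e '' closedBall (0 : EuclideanSpace ℝ (Fin (n + 1))) 1)ᶜ {e 0}ᶜ := by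
  intro z hz
  by_cases hzr : z ∈ range e
  · obtain ⟨w, rfl⟩ := hzr
    have hw : w ≠ 0 := fun h => hz (by rw [h]; rfl)
    refine ⟨e (ballExpand w), fun hmem => ?_, ?_⟩
    · obtain ⟨v, hv, hve⟩ := hmem
      rw [he.injective.eq_iff] at hve
      have := one_lt_norm_ballExpand hw
      rw [← hve, ← not_le] at this
      exact this (mem_closedBall_zero_iff.1 hv)
    · rw [discCollapse_apply_image he, ballCollapse_ballExpand hw]
  · exact ⟨z, fun h => hzr (image_subset_range _ _ h), discCollapse_apply_of_not_mem hzr⟩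

/-- The collapse maps the complement of the closed disc into the complement of the centre.
[folklore] -/
theorem discCollapse_mapsTo (he : IsOpenEmbedding e) :
    MapsTo (discCollapse e) (e '' closedBall (0 : EuclideanSpace ℝ (Fin (n + 1))) 1)ᶜ {e 0}ᶜ :=
  fun _ hy h => hy ((discCollapse_eq_center_iff he).1 h)

end DiscCollapse

/-! ### A closed manifold minus an open disc -/

namespace ClosedMinusBall

open SmaleHomologySpheres

variable {n : ℕ} {X : Type} [TopologicalSpace X] [T2Space X] [SecondCountableTopology X]
  [CompactSpace X] [ChartedSpace (EuclideanSpace ℝ (Fin (n + 1))) X] [IsManifold (𝓡 (n + 1)) ∞ X]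
  (D : BallRemovalData n (nullCobordismOfClosed n X).W)

/-- **`M₀ = X ∖ i(B)` bounds the ordinary sphere.** For a closed smooth `(n+1)`-manifold `X` and
ball-removal data `D` (a smooth disc `i : ℝⁿ⁺¹ → X`; `SmaleHomologySpheres.exists_ballRemovalData`:
one exists centred at any point), the glued manifold `K ≅ X ∖ i(B)` of `BallRemovalCobordism.lean`
is a null-cobordism of the standard sphere `𝕊ⁿ`, the boundary inclusion being `i` on the unit
sphere: the cobordism `(K; ∅, 𝕊ⁿ)` (`BallRemovalData.cobordism` of the null-cobordism `(X; ∅)`,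
`SmaleHomologySpheres.nullCobordismOfClosed`) reversed and read as a null-cobordism
(`NullCobordism.ofCobordism`). Kervaire–Milnor 1963, proof of Lemma 7.4 (p. 529): "Removing the
interior of an imbedded `4m`-disk from this manifold, we obtain the required … manifold `M₀`"
(with `bM₀` "the ordinary `(4m-1)`-sphere"); proof of Lemma 2.3 (p. 506).
[cite: KervaireMilnorAnnals1963, proof of Lemma 7.4 (p. 529) and proof of Lemma 2.3 (p. 506)] -/
def nullCobordism :
    NullCobordism n (Metric.sphere (0 : EuclideanSpace ℝ (Fin (n + 1))) 1) :=
  NullCobordism.ofCobordism (D.cobordism (nullCobordismOfClosed n X)).symm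

/-- The bounding manifold of `ClosedMinusBall.nullCobordism D` is the glued manifold `K`
(definitional). [folklore] -/
theorem nullCobordism_W : (nullCobordism D).W = D.K := rfl

/-- The boundary inclusion of `ClosedMinusBall.nullCobordism D` is the outgoing end `cobInr`
(the unit sphere of the second piece; definitional). [folklore] -/
theorem nullCobordism_incl (y : Metric.sphere (0 : EuclideanSpace ℝ (Fin (n + 1))) 1) :
    (nullCobordism D).incl y = D.cobInr (nullCobordismOfClosed n X) y := rfl

/-- **The identification `K → X`**, `K ≅ X ∖ i(B) ⊆ X`: the homeomorphism
`BallRemovalData.homeomorph` followed by the inclusion (and the identity `HalfSpaceCharted X = X`).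
[folklore] -/
def toClosed (k : D.K) : X :=
  (HalfSpaceCharted.ofHomeomorph (X := X)).symm
    ((D.homeomorph (nullCobordismOfClosed n X) k : (nullCobordismOfClosed n X).W))

/-- The identification `K → X` is continuous. [folklore] -/
theorem continuous_toClosed : Continuous (toClosed D) :=
  (HalfSpaceCharted.ofHomeomorph (X := X)).symm.continuous.comp
    (continuous_subtype_val.comp (D.homeomorph _).continuous)

/-- The identification `K → X` is a topological embedding. [folklore] -/
theorem isEmbedding_toClosed : IsEmbedding (toClosed D) :=
  (HalfSpaceCharted.ofHomeomorph (X := X)).symm.isEmbedding.comp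
    (IsEmbedding.subtypeVal.comp (D.homeomorph _).isEmbedding)

/-- The identification `K → X` is injective. [folklore] -/
theorem injective_toClosed : Injective (toClosed D) := (isEmbedding_toClosed D).injective

/-- On the boundary sphere the identification is the disc: `cobInr y ↦ i(y)`. [folklore] -/
theorem toClosed_cobInr (y : Metric.sphere (0 : EuclideanSpace ℝ (Fin (n + 1))) 1) :
    toClosed D (D.cobInr (nullCobordismOfClosed n X) y) = discX D y := by
  show (HalfSpaceCharted.ofHomeomorph (X := X)).symm _ = HalfSpaceCharted.of.symm (D.i y)
  rw [D.coe_homeomorph_cobInr]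
  rfl

/-- The image of the identification is the complement `X ∖ i(B)` of the open disc. [folklore] -/
theorem range_toClosed : range (toClosed D) = (discX D '' ball 0 1)ᶜ := by
  ext y
  constructor
  · rintro ⟨k, rfl⟩
    exact (D.homeomorph (nullCobordismOfClosed n X) k).2
  · intro hy
    refine ⟨(D.homeomorph (nullCobordismOfClosed n X)).symm ⟨HalfSpaceCharted.of y, hy⟩, ?_⟩
    simp only [toClosed, Homeomorph.apply_symm_apply]
    rfl

/-- A point of `K` is a boundary point iff it lies on the boundary sphere `cobInr(𝕊ⁿ)`.
[folklore] -/
theorem mem_boundary_iff (k : D.K) : k ∈ (𝓡∂ (n + 1)).boundary D.K ↔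
    ∃ y : Metric.sphere (0 : EuclideanSpace ℝ (Fin (n + 1))) 1,
      D.cobInr (nullCobordismOfClosed n X) y = k := by
  rw [boundary_K_eq_range D, mem_range]

/-- The identification carries exactly the boundary of `K` into the closed disc `i(𝔻)` (indeed
onto the sphere `i(Sⁿ)`). [folklore] -/
theorem toClosed_mem_image_closedBall_iff (k : D.K) :
    toClosed D k ∈ discX D '' closedBall 0 1 ↔ k ∈ (𝓡∂ (n + 1)).boundary D.K := by
  rw [mem_boundary_iff]
  constructor
  · rintro ⟨v, hv, hvk⟩
    have hv1 : ‖v‖ = 1 := by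
      refine le_antisymm (mem_closedBall_zero_iff.1 hv) (not_lt.1 fun hlt => ?_)
      have hmem : toClosed D k ∈ (discX D '' ball 0 1)ᶜ := range_toClosed D ▸ mem_range_self k
      exact hmem ⟨v, mem_ball_zero_iff.2 hlt, hvk⟩
    refine ⟨⟨v, mem_sphere_zero_iff_norm.2 hv1⟩, injective_toClosed D ?_⟩
    rw [toClosed_cobInr, hvk]
  · rintro ⟨y, rfl⟩
    rw [toClosed_cobInr]
    exact ⟨y, mem_closedBall_zero_iff.2 (norm_eq_of_mem_sphere y).le, rfl⟩

/-- **The collapse `K → X`**: the identification `K ≅ X ∖ i(B)` followed by the collapse of the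
closed disc `i(𝔻)` (whose trace on `X ∖ i(B)` is the sphere `i(Sⁿ) = ∂K`) to its centre. It is
Kervaire–Milnor's `M₀ → M₀ ∪ cone(bM₀) = M` for `M₀ = M ∖ D̊` (1963, footnote pp. 528–529).
[cite: KervaireMilnorAnnals1963, §7, footnote pp. 528–529] -/
def collapse (k : D.K) : X := discCollapse (discX D) (toClosed D k)

/-- The collapse `K → X` is continuous. [folklore] -/
theorem continuous_collapse : Continuous (collapse D) :=
  (continuous_discCollapse (isOpenEmbedding_discX D)).comp (continuous_toClosed D)

/-- The collapse sends the boundary sphere to the centre of the disc. [folklore] -/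
theorem collapse_of_mem_boundary {k : D.K} (hk : k ∈ (𝓡∂ (n + 1)).boundary D.K) :
    collapse D k = discX D 0 :=
  (discCollapse_eq_center_iff (isOpenEmbedding_discX D)).2
    ((toClosed_mem_image_closedBall_iff D k).2 hk)

/-- Off the boundary the collapse misses the centre. [folklore] -/
theorem collapse_ne_of_mem_interior {k : D.K} (hk : k ∈ (𝓡∂ (n + 1)).interior D.K) :
    collapse D k ≠ discX D 0 := fun h => by
  have hb := (toClosed_mem_image_closedBall_iff D k).1
    ((discCollapse_eq_center_iff (isOpenEmbedding_discX D)).1 h)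
  rw [← ModelWithCorners.compl_interior] at hb
  exact hb hk

/-- The collapse is injective on the interior. [folklore] -/
theorem collapse_injOn : InjOn (collapse D) ((𝓡∂ (n + 1)).interior D.K) := by
  intro k hk k' hk' h
  have hkc : toClosed D k ∈ (discX D '' closedBall 0 1)ᶜ := fun hm => by
    have := (toClosed_mem_image_closedBall_iff D k).1 hm
    rw [← ModelWithCorners.compl_interior] at this
    exact this hk
  have hkc' : toClosed D k' ∈ (discX D '' closedBall 0 1)ᶜ := fun hm => by
    have := (toClosed_mem_image_closedBall_iff D k').1 hm
    rw [← ModelWithCorners.compl_interior] at this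
    exact this hk'
  exact injective_toClosed D (discCollapse_injOn (isOpenEmbedding_discX D) hkc hkc' h)

/-- The collapse maps the interior onto the punctured manifold `X ∖ {i 0}`. [folklore] -/
theorem collapse_surjOn : SurjOn (collapse D) ((𝓡∂ (n + 1)).interior D.K) {discX D 0}ᶜ := by
  intro z hz
  obtain ⟨y, hy, rfl⟩ := discCollapse_surjOn (isOpenEmbedding_discX D) hz
  have hyr : y ∈ range (toClosed D) := by
    rw [range_toClosed]
    exact fun hm => hy (image_mono ball_subset_closedBall hm)
  obtain ⟨k, rfl⟩ := hyr
  refine ⟨k, ?_, rfl⟩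
  by_contra hk
  rw [← ModelWithCorners.compl_boundary, mem_compl_iff, not_not] at hk
  exact hy ((toClosed_mem_image_closedBall_iff D k).2 hk)

/-- **The map `K ∪ cone(∂K) → X` induced by the collapse** on the closed model
`ClosedModel n K` (one-point compactification of the interior): the collapse on the interior,
`∞ ↦ i 0`. [cite: KervaireMilnorAnnals1963, §7, footnote pp. 528–529] -/
def closedModelToClosed : ClosedModel n D.K → X
  | none => discX D 0
  | some q => collapse D q.1

/-- The value at the cone point. [folklore] -/
@[simp] theorem closedModelToClosed_infty : closedModelToClosed D ClosedModel.infty = discX D 0 :=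
  rfl

/-- The value at an interior point. [folklore] -/
@[simp] theorem closedModelToClosed_ofInterior (q : ManifoldInterior n D.K) :
    closedModelToClosed D (ClosedModel.ofInterior q) = collapse D q.1 := rfl

/-- The induced map composed with the boundary collapse `K → K ∪ cone(∂K)` is the collapse
`K → X`. [folklore] -/
theorem closedModelToClosed_boundaryCollapse (k : D.K) :
    closedModelToClosed D (boundaryCollapse n D.K k) = collapse D k := by
  by_cases hk : k ∈ (𝓡∂ (n + 1)).interior D.K
  · rw [boundaryCollapse_apply, boundaryCollapseFun_of_mem hk]
    rfl
  · rw [boundaryCollapse_apply, boundaryCollapseFun_of_not_mem hk, closedModelToClosed_infty,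
      collapse_of_mem_boundary]
    rwa [← ModelWithCorners.compl_interior]

/-- The boundary collapse `K → K ∪ cone(∂K)` is a quotient map (a continuous closed surjection
from a compact space onto a Hausdorff space; the boundary is nonempty). [folklore] -/
theorem isQuotientMap_boundaryCollapse : IsQuotientMap (boundaryCollapse n D.K) := by
  refine ((boundaryCollapse n D.K).continuous.isClosedMap).isQuotientMap
    (boundaryCollapse n D.K).continuous ?_
  rintro (_ | q)
  · haveI : Nonempty (Metric.sphere (0 : EuclideanSpace ℝ (Fin (n + 1))) 1) :=
      ⟨⟨EuclideanSpace.single 0 1, by simp⟩⟩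
    obtain ⟨y⟩ := this
    refine ⟨D.cobInr (nullCobordismOfClosed n X) y, ?_⟩
    have hb : D.cobInr (nullCobordismOfClosed n X) y ∉ (𝓡∂ (n + 1)).interior D.K := by
      rw [← ModelWithCorners.compl_boundary, mem_compl_iff, not_not]
      exact (mem_boundary_iff D _).2 ⟨y, rfl⟩
    rw [boundaryCollapse_apply, boundaryCollapseFun_of_not_mem hb]
    rfl
  · exact ⟨q.1, by rw [boundaryCollapse_apply, boundaryCollapseFun_of_mem q.2]; rfl⟩

/-- The induced map `K ∪ cone(∂K) → X` is continuous. [folklore] -/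
theorem continuous_closedModelToClosed : Continuous (closedModelToClosed D) := by
  rw [(isQuotientMap_boundaryCollapse D).continuous_iff]
  have : closedModelToClosed D ∘ boundaryCollapse n D.K = collapse D :=
    funext (closedModelToClosed_boundaryCollapse D)
  rw [this]
  exact continuous_collapse D

/-- The induced map `K ∪ cone(∂K) → X` is a bijection. [folklore] -/
theorem bijective_closedModelToClosed : Bijective (closedModelToClosed D) := by
  constructor
  · rintro (_ | q) (_ | q') h
    · rfl
    · exact absurd h.symm (collapse_ne_of_mem_interior D q'.2)
    · exact absurd h (collapse_ne_of_mem_interior D q.2)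
    · change collapse D q.1 = collapse D q'.1 at h
      have := collapse_injOn D q.2 q'.2 h
      exact congrArg some (Subtype.ext this)
  · intro z
    by_cases hz : z = discX D 0
    · exact ⟨none, hz.symm⟩
    · obtain ⟨k, hk, rfl⟩ := collapse_surjOn D hz
      exact ⟨some ⟨k, hk⟩, rfl⟩

/-- **The closed model of `X ∖ i(B)` is `X`.** For a closed smooth manifold `X` and a smooth
disc `i`, the one-point compactification `K ∪ cone(∂K)` of the interior of `K ≅ X ∖ i(B)`
(the tree's `ClosedModel`, on which Kervaire–Milnor's `σ(M₀)` is computed) is homeomorphic to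
`X`, by the map collapsing the closed disc `i(𝔻)` to its centre: a continuous bijection from a
compact space onto a Hausdorff space. Kervaire–Milnor 1963, footnote pp. 528–529 ("adjoin a cone
over the boundary") with the proof of Lemma 7.4, p. 529 (`M₀ = M ∖ D̊`, so that
`M₀ ∪ cone(bM₀) = M`). [cite: KervaireMilnorAnnals1963, §7, footnote pp. 528–529 and proof of Lemma 7.4 (p. 529)] -/
def closedModelHomeomorph : ClosedModel n D.K ≃ₜ X :=
  Continuous.homeoOfEquivCompactToT2
    (f := Equiv.ofBijective (closedModelToClosed D) (bijective_closedModelToClosed D))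
    (continuous_closedModelToClosed D)

/-- The homeomorphism is the induced map (definitional). [folklore] -/
@[simp] theorem closedModelHomeomorph_apply (z : ClosedModel n D.K) :
    closedModelHomeomorph D z = closedModelToClosed D z := rfl

/-- The homeomorphism sends the cone point to the centre of the removed disc. [folklore] -/
theorem closedModelHomeomorph_infty : closedModelHomeomorph D ClosedModel.infty = discX D 0 := rfl

/-- **`X ∖ i(B)` is path connected** for `X` connected of dimension `n + 1 ≥ 2`: it is a retract of
the punctured manifold `X ∖ {i 0}` (`BallComplement.retr`), which is path connected
(`isPathConnected_compl_singleton_of_chartedSpace`). [folklore] -/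
theorem pathConnectedSpace_K [ConnectedSpace X] (hn : 1 ≤ n) : PathConnectedSpace D.K := by
  haveI : LocallyPathConnectedSpace X := ChartedSpace.locallyPathConnectedSpace
    (EuclideanSpace ℝ (Fin (n + 1))) X
  haveI : PathConnectedSpace X := pathConnectedSpace_iff_connectedSpace.2 inferInstance
  -- the punctured manifold is path connected
  have h1 : IsPathConnected ({discX D 0}ᶜ : Set X) :=
    Literature.AlgebraicTopology.Homotopy.isPathConnected_compl_singleton_of_chartedSpace
      (E := EuclideanSpace ℝ (Fin (n + 1))) (by simp; omega) (discX D 0)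
  haveI : PathConnectedSpace ↥({discX D 0}ᶜ : Set X) := isPathConnected_iff_pathConnectedSpace.1 h1
  -- the complement of the open disc is its retract
  have h2 : IsPathConnected ((discX D '' ball 0 1)ᶜ : Set X) := by
    have hr := isPathConnected_range
      ((continuous_subtype_val.comp
        (Literature.AlgebraicTopology.Homotopy.BallComplement.retr
          (isOpenEmbedding_discX D)).continuous))
    convert hr using 1
    ext y
    simp only [mem_range, comp_apply]
    constructor
    · intro hy
      exact ⟨Literature.AlgebraicTopology.Homotopy.BallComplement.incl ⟨y, hy⟩, by
        rw [← ContinuousMap.comp_apply,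
          Literature.AlgebraicTopology.Homotopy.BallComplement.retr_comp_incl]; rfl⟩
    · rintro ⟨w, rfl⟩
      exact Subtype.prop _
  rw [← range_toClosed] at h2
  rw [pathConnectedSpace_iff_univ, (isEmbedding_toClosed D).isInducing.isPathConnected_iff,
    image_univ]
  exact h2

/-- `X ∖ i(B)` is connected for `X` connected of dimension `n + 1 ≥ 2`. [folklore] -/
theorem connectedSpace_K [ConnectedSpace X] (hn : 1 ≤ n) : ConnectedSpace D.K := by
  haveI := pathConnectedSpace_K D hn
  infer_instance

end ClosedMinusBall

end Literature.Topology.FourManifolds
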